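import Mathlib
import Summits.NavierStokesRegularity.NavierStokesRegularity.Theorems.EulerZoomLiouvillePowerGaugeEulerLiouvilleIrrotationalTools
import Literature.Analysis.FluidPDE.DivCurlAnnihilator
import Literature.Analysis.FluidPDE.WeakGradientIBP
import Literature.Analysis.FluidPDE.SolenoidalTruncation
import HarnessLib

/-!
# Crux E `PowerGaugeEulerLiouville` (stmt-NavierStokesRegularity-19832), line `galilean-frames` (ns-idea-11 g6), stub F1e:
# FIRST LEMMA `Sig.lemma_harmonicShearVanishes` — HARMONIC SHEAR VANISHES UNDER THE A-GAUGE (width seat ns-ezl-w3 g4)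

Route №10 `EulerZoomLiouville` (NavierStokesRegularity), crux E.  The line `galilean-frames`
(`Cruxes/PowerGaugeEulerLiouville/Lines/galilean_frames.lean`, rev5) types, as the checkable core of lever (L2) of its open stub F1e
(`stub_frameSteadyEscaping`), the lemma

> `Sig.lemma_harmonicShearVanishes`: a locally integrable field `U` on `ℝ³` that is weakly divergence-free, has the slice growth
> `∫⁻_{B_R} ‖U + κ‖² ≤ C R^{1−2ρ}` (`R ≥ 1`) and whose directional derivative `∂_e U` is WEAKLY A GRADIENT — `∫ ⟪U, DΦ·e⟫ = 0` for every smooth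
> compactly supported trace-free `Φ` — is invariant under the translations along `e`: `U(· + s e) = U` a.e. for every `s`.

This file proves it BODY-VERBATIM (`GalileanFrames.harmonicShearVanishes`; the line's `theorem lemma_harmonicShearVanishes :
Sig.lemma_harmonicShearVanishes` is then `exact` this).  ROUTE (tree tools only — no mollifier, no de Rham): for fixed `s` the increment
`D := U(· + s e) − U` is locally integrable and weakly divergence-free, and it ANNIHILATES EVERY CURL PAIR `Ξ = (∂ₐg) c − (∂_c g) a`:
the function `t ↦ ∫ ⟪U, Ξ(· − t e)⟫` has derivative `−∫ ⟪U, D[Ξ(· − t e)] e⟫ = 0` (parametric differentiation under the integral; the translate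
`Ξ(· − te)` is a trace-free test field, `trace_fderiv_curlPair`), hence is constant (`integral_inner_comp_sub_eq_of_shear`), and
`∫ ⟪D, Ξ⟫ = ∫⟪U, Ξ(· − se)⟫ − ∫⟪U, Ξ⟫ = 0` by translation invariance of Lebesgue measure.  Therefore every component of `D` is weakly harmonic
(`Literature…integral_laplacian_mul_inner_eq_zero_of_curlPair`, Lemarié-Rieusset's `div/curl` identity) with sub-volume `L²` growth (exponent
`1 − 2ρ < 3`), so `D = 0` a.e. by the lineage's growth Liouville `ae_eq_zero_of_weaklyHarmonic_of_growth` (`…IrrotationalTools`).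

WHAT THIS IS NOT: not NS regularity, not the crux E, not F1e (whose steps (ii)–(iv) — distributional bookkeeping of the frame-steady member —
stay OPEN) — a pure-analysis first lemma of one line of the crux CLASS 19832 (MODEL lattice; E/NS strata), `--supports` stmt-19832; 19832 OPEN.
[cite: LemarieRieusset2016, proof of Thm 4.4 pp. 56–57; GilbargTrudinger2001, Thm 2.1 (mean value)]
-/

noncomputable section

-- flat `Theorems/<Route><Decl>…` files of one crux share the namespace of the crux (tree convention: `Summit.<S>.<S>.…`)
set_option linter.dupNamespace false

open MeasureTheory Set Filter Topology Metric Function TopologicalSpace InnerProductSpace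
open scoped ENNReal NNReal RealInnerProductSpace Laplacian ContDiff

namespace Summit.NavierStokesRegularity.NavierStokesRegularity.Theorems.PowerGaugeEulerLiouville

namespace GalileanFrames

open Literature.Analysis Literature.Analysis.FunctionSpaces Literature.Analysis.FluidPDE
open Summit.NavierStokesRegularity.NavierStokesRegularity.Theorems.PowerGaugeEulerLiouville

/-! ### Translates of test functions -/

/-- A translate of a test function on the whole space is a test function. [folklore] -/
theorem isTestFunctionOn_comp_sub {G : Type*} [NormedAddCommGroup G] [NormedSpace ℝ G]
    {φ : EuclideanSpace ℝ (Fin 3) → G} (hφ : IsTestFunctionOn (⊤ : Opens (EuclideanSpace ℝ (Fin 3))) φ) (v : EuclideanSpace ℝ (Fin 3)) :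
    IsTestFunctionOn (⊤ : Opens (EuclideanSpace ℝ (Fin 3))) (fun x => φ (x - v)) where
  contDiff := hφ.contDiff.comp (contDiff_id.sub contDiff_const)
  hasCompactSupport := by
    have h := hφ.hasCompactSupport.comp_homeomorph (Homeomorph.addRight (-v))
    have e : (φ ∘ (Homeomorph.addRight (-v))) = fun x => φ (x - v) := by
      funext x; simp [sub_eq_add_neg]
    rwa [e] at h
  tsupport_subset := by simp

/-- The differential of a translate is the translate of the differential. [folklore] -/
theorem fderiv_comp_sub_apply {G : Type*} [NormedAddCommGroup G] [NormedSpace ℝ G]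
    (φ : EuclideanSpace ℝ (Fin 3) → G) (v z : EuclideanSpace ℝ (Fin 3)) :
    fderiv ℝ (fun x => φ (x - v)) z = fderiv ℝ φ (z - v) :=
  fderiv_comp_sub v

/-! ### Curl pairs are trace-free -/

/-- **The differential of a curl pair is trace-free**: for `g ∈ C^∞(ℝ³)` and vectors `a, c`, the field `Ξ = (∂ₐ g) c − (∂_c g) a` has
`tr DΞ(z) = ∂_c∂_a g − ∂_a∂_c g = 0` (symmetry of second derivatives). [folklore] -/
theorem trace_fderiv_curlPair {g : EuclideanSpace ℝ (Fin 3) → ℝ} (hg : ContDiff ℝ (⊤ : ℕ∞) g) (a c z : EuclideanSpace ℝ (Fin 3)) :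
    LinearMap.trace ℝ (EuclideanSpace ℝ (Fin 3))
      ((fderiv ℝ (fun x => fderiv ℝ g x a • c - fderiv ℝ g x c • a) z :
        EuclideanSpace ℝ (Fin 3) →L[ℝ] EuclideanSpace ℝ (Fin 3)) : EuclideanSpace ℝ (Fin 3) →ₗ[ℝ] EuclideanSpace ℝ (Fin 3)) = 0 := by
  set H : EuclideanSpace ℝ (Fin 3) →L[ℝ] EuclideanSpace ℝ (Fin 3) →L[ℝ] ℝ := fderiv ℝ (fderiv ℝ g) z with hH
  have hg1 : Differentiable ℝ (fderiv ℝ g) :=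
    (hg.fderiv_right (m := 1) (by norm_cast)).differentiable one_ne_zero
  have hDg : HasFDerivAt (fderiv ℝ g) H z := (hg1 z).hasFDerivAt
  -- `D(x ↦ Dg(x) v) (z) = H.flip v`
  have hcomp : ∀ v : EuclideanSpace ℝ (Fin 3), HasFDerivAt (fun x => fderiv ℝ g x v) (H.flip v) z := by
    intro v
    have h := hDg.clm_apply (hasFDerivAt_const v z)
    simpa using h
  have hΞ : HasFDerivAt (fun x => fderiv ℝ g x a • c - fderiv ℝ g x c • a)
      ((H.flip a).smulRight c - (H.flip c).smulRight a) z :=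
    ((hcomp a).smul_const c).sub ((hcomp c).smul_const a)
  rw [hΞ.fderiv, ContinuousLinearMap.toLinearMap_sub, map_sub]
  have htr : ∀ (ℓ : EuclideanSpace ℝ (Fin 3) →L[ℝ] ℝ) (y : EuclideanSpace ℝ (Fin 3)),
      LinearMap.trace ℝ _ ((ℓ.smulRight y : EuclideanSpace ℝ (Fin 3) →L[ℝ] EuclideanSpace ℝ (Fin 3)) :
        EuclideanSpace ℝ (Fin 3) →ₗ[ℝ] EuclideanSpace ℝ (Fin 3)) = ℓ y := by
    intro ℓ y
    have e : ((ℓ.smulRight y : EuclideanSpace ℝ (Fin 3) →L[ℝ] EuclideanSpace ℝ (Fin 3)) :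
        EuclideanSpace ℝ (Fin 3) →ₗ[ℝ] EuclideanSpace ℝ (Fin 3)) = (ℓ : EuclideanSpace ℝ (Fin 3) →ₗ[ℝ] ℝ).smulRight y := by
      ext u; simp
    rw [e, LinearMap.trace_smulRight]
    rfl
  rw [htr, htr, ContinuousLinearMap.flip_apply, ContinuousLinearMap.flip_apply]
  -- symmetry of the second derivative
  have hg2 : ContDiff ℝ 2 g := contDiff_infty.1 hg 2
  have hsymm : IsSymmSndFDerivAt ℝ g z := (hg2.contDiffAt (x := z)).isSymmSndFDerivAt (n := 2) (by simp)
  rw [hH, hsymm c a, sub_self]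

/-! ### Curl pairs against a weak shear: the translation argument -/

/-- **Pairings with translates are constant when the shear is weakly orthogonal.**  `U ∈ L¹_loc(ℝ³; ℝ³)`, `Ξ` a (vector) test function, `e` a
direction, and `∫ ⟪U, DΞ(· − t e) e⟫ = 0` for every `t`.  Then `∫ ⟪U, Ξ(· − s e)⟫ = ∫ ⟪U, Ξ⟫` for every `s` (the function
`t ↦ ∫⟪U, Ξ(· − te)⟫` is differentiable with derivative `−∫⟪U, DΞ(· − te) e⟫ = 0`, by dominated differentiation under the integral).
[folklore] -/
theorem integral_inner_comp_sub_eq_of_shear {U Ξ : EuclideanSpace ℝ (Fin 3) → EuclideanSpace ℝ (Fin 3)}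
    (hU : LocallyIntegrable U volume) (hΞ : IsTestFunctionOn (⊤ : Opens (EuclideanSpace ℝ (Fin 3))) Ξ) (e : EuclideanSpace ℝ (Fin 3))
    (horth : ∀ t : ℝ, ∫ z, ⟪U z, (fderiv ℝ Ξ (z - t • e)) e⟫ = 0) (s : ℝ) :
    ∫ z, ⟪U z, Ξ (z - s • e)⟫ = ∫ z, ⟪U z, Ξ z⟫ := by
  have hΞc : Continuous Ξ := hΞ.contDiff.continuous
  have hΞd : Differentiable ℝ Ξ := hΞ.contDiff.differentiable (by simp)
  have hDΞc : Continuous (fderiv ℝ Ξ) := hΞ.contDiff.continuous_fderiv (by simp)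
  have hDΞs : HasCompactSupport (fderiv ℝ Ξ) := hΞ.hasCompactSupport.fderiv (𝕜 := ℝ)
  -- a uniform bound for `DΞ` and a radius containing the support of `Ξ`
  obtain ⟨M, hM⟩ := hDΞc.bounded_above_of_compact_support hDΞs
  have hM0 : 0 ≤ M := (norm_nonneg _).trans (hM 0)
  obtain ⟨R₀, hR₀⟩ := (hΞ.hasCompactSupport.isCompact.isBounded).subset_closedBall (0 : EuclideanSpace ℝ (Fin 3))
  -- the pairing and its `t`-derivative
  set I : ℝ → ℝ := fun t => ∫ z, ⟪U z, Ξ (z - t • e)⟫ with hI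
  set F' : ℝ → EuclideanSpace ℝ (Fin 3) → ℝ := fun t z => ⟪U z, (fderiv ℝ Ξ (z - t • e)) (-e)⟫ with hF'
  have hline : ∀ (z : EuclideanSpace ℝ (Fin 3)) (t : ℝ), HasDerivAt (fun t : ℝ => z - t • e) (-e) t := by
    intro z t
    have h := ((hasDerivAt_id t).smul_const e).const_sub z
    simpa using h
  have hderiv : ∀ t₀ : ℝ, HasDerivAt I 0 t₀ := by
    intro t₀
    -- the dominating function: `M ‖e‖ ‖U‖` on a big ball, `0` outside
    set K : Set (EuclideanSpace ℝ (Fin 3)) := closedBall 0 (R₀ + (|t₀| + 1) * ‖e‖) with hK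
    have hKc : IsCompact K := isCompact_closedBall _ _
    set bound : EuclideanSpace ℝ (Fin 3) → ℝ := K.indicator fun z => M * ‖e‖ * ‖U z‖ with hbound
    have hbound_int : Integrable bound volume := by
      rw [hbound, integrable_indicator_iff hKc.measurableSet]
      exact ((hU.integrableOn_isCompact hKc).norm.const_mul (M * ‖e‖))
    have hF_meas : ∀ t : ℝ, AEStronglyMeasurable (fun z => ⟪U z, Ξ (z - t • e)⟫) volume := fun t =>
      hU.aestronglyMeasurable.inner (hΞc.comp (continuous_id.sub continuous_const)).aestronglyMeasurable
    have hF_int : Integrable (fun z => ⟪U z, Ξ (z - t₀ • e)⟫) volume :=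
      integrable_inner_of_locallyIntegrable_of_hasCompactSupport hU (hΞc.comp (continuous_id.sub continuous_const))
        (isTestFunctionOn_comp_sub hΞ (t₀ • e)).hasCompactSupport
    have hF'_meas : AEStronglyMeasurable (F' t₀) volume :=
      hU.aestronglyMeasurable.inner
        ((hDΞc.comp (continuous_id.sub continuous_const)).clm_apply continuous_const).aestronglyMeasurable
    -- the bound
    have h_bound : ∀ᵐ z ∂(volume : Measure (EuclideanSpace ℝ (Fin 3))), ∀ t ∈ ball t₀ 1, ‖F' t z‖ ≤ bound z := by
      refine ae_of_all _ fun z t ht => ?_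
      have ht' : |t| < |t₀| + 1 := by
        have := mem_ball_iff_norm.1 ht
        rw [Real.norm_eq_abs] at this
        have := abs_sub_abs_le_abs_sub t t₀
        linarith
      by_cases hz : z ∈ K
      · rw [hbound, indicator_of_mem hz, hF']
        calc ‖⟪U z, (fderiv ℝ Ξ (z - t • e)) (-e)⟫‖ ≤ ‖U z‖ * ‖(fderiv ℝ Ξ (z - t • e)) (-e)‖ := norm_inner_le_norm _ _
          _ ≤ ‖U z‖ * (M * ‖e‖) := by
              gcongr
              calc ‖(fderiv ℝ Ξ (z - t • e)) (-e)‖ ≤ ‖fderiv ℝ Ξ (z - t • e)‖ * ‖-e‖ := ContinuousLinearMap.le_opNorm _ _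
                _ ≤ M * ‖e‖ := by rw [norm_neg]; exact mul_le_mul_of_nonneg_right (hM _) (norm_nonneg _)
          _ = M * ‖e‖ * ‖U z‖ := by ring
      · -- off `K` the translate misses the support of `Ξ`, so `DΞ(z − te) = 0`
        have hzt : z - t • e ∉ tsupport Ξ := by
          intro hmem
          have h1 : ‖z - t • e‖ ≤ R₀ := mem_closedBall_zero_iff.1 (hR₀ hmem)
          have h2 : ‖z‖ ≤ ‖z - t • e‖ + ‖t • e‖ := norm_le_norm_sub_add z (t • e)
          rw [norm_smul, Real.norm_eq_abs] at h2
          apply hz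
          rw [hK, mem_closedBall_zero_iff]
          nlinarith [norm_nonneg e, abs_nonneg t]
        have hD0 : fderiv ℝ Ξ (z - t • e) = 0 := by
          by_contra hne
          exact hzt (support_fderiv_subset ℝ (mem_support.2 hne))
        rw [hbound, indicator_of_notMem hz]
        simp only [hF', hD0, zero_apply, inner_zero_right, norm_zero, le_refl]
    -- pointwise derivative
    have h_diff : ∀ᵐ z ∂(volume : Measure (EuclideanSpace ℝ (Fin 3))), ∀ t ∈ ball t₀ 1,
        HasDerivAt (fun t : ℝ => ⟪U z, Ξ (z - t • e)⟫) (F' t z) t := by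
      refine ae_of_all _ fun z t _ => ?_
      have hg : HasDerivAt (fun t : ℝ => Ξ (z - t • e)) ((fderiv ℝ Ξ (z - t • e)) (-e)) t :=
        (hΞd (z - t • e)).hasFDerivAt.comp_hasDerivAt t (hline z t)
      have h := (hasDerivAt_const t (U z)).inner ℝ hg
      simpa [hF'] using h
    have hmain := hasDerivAt_integral_of_dominated_loc_of_deriv_le (ball_mem_nhds t₀ one_pos)
      (Eventually.of_forall hF_meas) hF_int hF'_meas h_bound hbound_int h_diff
    -- the derivative is `−∫⟪U, DΞ(· − t₀e) e⟫ = 0`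
    have hval : ∫ z, F' t₀ z = 0 := by
      have e1 : (fun z => F' t₀ z) = fun z => -⟪U z, (fderiv ℝ Ξ (z - t₀ • e)) e⟫ := by
        funext z; simp only [hF', map_neg, inner_neg_right]
      rw [e1, integral_neg, horth t₀, neg_zero]
    rw [hval] at hmain
    exact hmain.2
  have hdiffI : Differentiable ℝ I := fun t => (hderiv t).differentiableAt
  have hI0 : ∀ t, deriv I t = 0 := fun t => (hderiv t).deriv
  have hconst := is_const_of_deriv_eq_zero hdiffI hI0 s 0
  simpa only [hI, zero_smul, sub_zero] using hconst


/-! ### Translates of a locally integrable field -/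

/-- A translate of a locally integrable field is locally integrable (translation invariance of Lebesgue measure). [folklore] -/
theorem locallyIntegrable_comp_add_right {U : EuclideanSpace ℝ (Fin 3) → EuclideanSpace ℝ (Fin 3)}
    (hU : LocallyIntegrable U volume) (v : EuclideanSpace ℝ (Fin 3)) :
    LocallyIntegrable (fun z => U (z + v)) volume := by
  have hmap : Measure.map (Homeomorph.addRight v) (volume : Measure (EuclideanSpace ℝ (Fin 3))) = volume := by
    have e : ⇑(Homeomorph.addRight v) = fun z : EuclideanSpace ℝ (Fin 3) => z + v := rfl
    rw [e]
    exact map_add_right_eq_self volume v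
  have h := (locallyIntegrable_map_homeomorph (Homeomorph.addRight v) (f := U)
    (μ := (volume : Measure (EuclideanSpace ℝ (Fin 3))))).1 (by rw [hmap]; exact hU)
  exact h

/-- Translating the field is translating the test field: `∫ ⟪U(z + v), Ξ z⟫ = ∫ ⟪U z, Ξ(z − v)⟫`. [folklore] -/
theorem integral_inner_comp_add_eq (U Ξ : EuclideanSpace ℝ (Fin 3) → EuclideanSpace ℝ (Fin 3)) (v : EuclideanSpace ℝ (Fin 3)) :
    ∫ z, ⟪U (z + v), Ξ z⟫ = ∫ z, ⟪U z, Ξ (z - v)⟫ := by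
  have h := integral_add_right_eq_self (μ := (volume : Measure (EuclideanSpace ℝ (Fin 3))))
    (fun y => ⟪U y, Ξ (y - v)⟫) v
  simp only [add_sub_cancel_right] at h
  exact h

/-- Translated ball integrals: `∫⁻_{B(0,r)} F(z + v) dz = ∫⁻_{B(v,r)} F`. [folklore] -/
theorem setLIntegral_ball_comp_add_right (F : EuclideanSpace ℝ (Fin 3) → ℝ≥0∞) (v : EuclideanSpace ℝ (Fin 3)) (r : ℝ) :
    ∫⁻ z in ball (0 : EuclideanSpace ℝ (Fin 3)) r, F (z + v) = ∫⁻ y in ball v r, F y := by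
  have h := (measurePreserving_add_right (volume : Measure (EuclideanSpace ℝ (Fin 3))) v).setLIntegral_comp_preimage_emb
    (MeasurableEquiv.addRight v).measurableEmbedding F (ball v r)
  have hpre : (fun z : EuclideanSpace ℝ (Fin 3) => z + v) ⁻¹' ball v r = ball 0 r := by
    ext z
    simp [mem_ball, dist_eq_norm]
  rw [hpre] at h
  exact h

/-! ### The theorem -/

/-- **HARMONIC SHEAR VANISHES UNDER THE A-GAUGE** (`Sig.lemma_harmonicShearVanishes` of `Lines/galilean_frames.lean`, body verbatim).  A locally integrable
field `U` on `ℝ³`, weakly divergence-free, with the slice growth `∫⁻_{B_R}‖U + κ‖² ≤ C R^{1−2ρ}` (`R ≥ 1`, `ρ > 0`), whose directional derivative `∂_eU`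
is weakly a gradient (`∫⟪U, DΦ e⟫ = 0` for every smooth compactly supported trace-free `Φ`), satisfies `U(· + s e) = U` a.e. for every `s`.
[cite: LemarieRieusset2016, proof of Thm 4.4 pp. 56–57; GilbargTrudinger2001, Thm 2.1] -/
theorem harmonicShearVanishes :
    ∀ ρ : ℝ, 0 < ρ → ∀ (U : EuclideanSpace ℝ (Fin 3) → EuclideanSpace ℝ (Fin 3)) (κ e : EuclideanSpace ℝ (Fin 3)) (C : ℝ),
    LocallyIntegrable U volume →
    (∀ R : ℝ, 1 ≤ R → ∫⁻ z in Metric.ball (0 : EuclideanSpace ℝ (Fin 3)) R, ‖U z + κ‖ₑ ^ 2 ≤ ENNReal.ofReal (C * R ^ (1 - 2 * ρ))) →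
    (∀ φ : EuclideanSpace ℝ (Fin 3) → ℝ, ContDiff ℝ (⊤ : ℕ∞) φ → HasCompactSupport φ → ∫ z, ⟪U z, gradient φ z⟫ = 0) →
    (∀ Φ : EuclideanSpace ℝ (Fin 3) → EuclideanSpace ℝ (Fin 3), ContDiff ℝ (⊤ : ℕ∞) Φ → HasCompactSupport Φ →
      (∀ z, LinearMap.trace ℝ (EuclideanSpace ℝ (Fin 3))
        ((fderiv ℝ Φ z : EuclideanSpace ℝ (Fin 3) →L[ℝ] EuclideanSpace ℝ (Fin 3)) :
          EuclideanSpace ℝ (Fin 3) →ₗ[ℝ] EuclideanSpace ℝ (Fin 3)) = 0) →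
      ∫ z, ⟪U z, (fderiv ℝ Φ z) e⟫ = 0) →
    ∀ s : ℝ, (fun z => U (z + s • e)) =ᵐ[volume] U := by
  intro ρ hρ U κ e C hUl hgrow hdivU hshear s
  -- the increment `D = U(· + s e) − U`
  have hUsl : LocallyIntegrable (fun z => U (z + s • e)) volume := locallyIntegrable_comp_add_right hUl (s • e)
  set D : EuclideanSpace ℝ (Fin 3) → EuclideanSpace ℝ (Fin 3) := fun z => U (z + s • e) - U z with hD
  have hDl : LocallyIntegrable D volume := hUsl.sub hUl
  -- pairings of `D` with test fields split
  have hsplit : ∀ Ξ : EuclideanSpace ℝ (Fin 3) → EuclideanSpace ℝ (Fin 3),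
      IsTestFunctionOn (⊤ : Opens (EuclideanSpace ℝ (Fin 3))) Ξ →
      ∫ z, ⟪D z, Ξ z⟫ = (∫ z, ⟪U z, Ξ (z - s • e)⟫) - ∫ z, ⟪U z, Ξ z⟫ := by
    intro Ξ hΞ
    have hΞc : Continuous Ξ := hΞ.contDiff.continuous
    have i1 : Integrable (fun z => ⟪U (z + s • e), Ξ z⟫) volume :=
      integrable_inner_of_locallyIntegrable_of_hasCompactSupport hUsl hΞc hΞ.hasCompactSupport
    have i2 : Integrable (fun z => ⟪U z, Ξ z⟫) volume :=
      integrable_inner_of_locallyIntegrable_of_hasCompactSupport hUl hΞc hΞ.hasCompactSupport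
    have e1 : (fun z => ⟪D z, Ξ z⟫) = fun z => ⟪U (z + s • e), Ξ z⟫ - ⟪U z, Ξ z⟫ := by
      funext z; rw [hD, inner_sub_left]
    rw [e1, integral_sub i1 i2, integral_inner_comp_add_eq]
  -- (1) `D` is weakly divergence-free
  have hDdiv : IsWeaklyDivFree D := by
    intro θ hθ
    set θs : EuclideanSpace ℝ (Fin 3) → ℝ := fun x => θ (x - s • e) with hθs
    have hθs' : IsTestFunctionOn (⊤ : Opens (EuclideanSpace ℝ (Fin 3))) θs := isTestFunctionOn_comp_sub hθ (s • e)
    -- the gradient field of `θ` is a test field, and its translate is the gradient field of `θs`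
    have hG : IsTestFunctionOn (⊤ : Opens (EuclideanSpace ℝ (Fin 3))) (gradient θ) :=
      { contDiff := by
          refine contDiff_infty.2 fun n => ?_
          exact (InnerProductSpace.toDual ℝ (EuclideanSpace ℝ (Fin 3))).symm.contDiff.comp
            (hθ.contDiff.fderiv_right (m := n) (by exact_mod_cast le_top))
        hasCompactSupport := (hθ.hasCompactSupport.fderiv (𝕜 := ℝ)).comp_left
          (g := (InnerProductSpace.toDual ℝ (EuclideanSpace ℝ (Fin 3))).symm) (map_zero _)
        tsupport_subset := by simp }
    have hgrad : ∀ z, gradient θ (z - s • e) = gradient θs z := by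
      intro z; rw [hθs, gradient, gradient, fderiv_comp_sub]
    rw [hsplit _ hG]
    simp_rw [hgrad]
    rw [hdivU θs hθs'.contDiff hθs'.hasCompactSupport, hdivU θ hθ.contDiff hθ.hasCompactSupport, sub_zero]
  -- (2) `D` annihilates every curl pair
  have hDcurl : ∀ g : EuclideanSpace ℝ (Fin 3) → ℝ, IsTestFunctionOn (⊤ : Opens (EuclideanSpace ℝ (Fin 3))) g →
      ∀ a c : EuclideanSpace ℝ (Fin 3), ∫ x, ⟪D x, fderiv ℝ g x a • c - fderiv ℝ g x c • a⟫ = 0 := by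
    intro g hg a c
    set Ξ : EuclideanSpace ℝ (Fin 3) → EuclideanSpace ℝ (Fin 3) := fun x => fderiv ℝ g x a • c - fderiv ℝ g x c • a with hΞ
    have hΞt : IsTestFunctionOn (⊤ : Opens (EuclideanSpace ℝ (Fin 3))) Ξ := isTestFunctionOn_curlPair hg a c
    -- every translate of `Ξ` is a trace-free test field, so the shear hypothesis applies to it
    have horth : ∀ t : ℝ, ∫ z, ⟪U z, (fderiv ℝ Ξ (z - t • e)) e⟫ = 0 := by
      intro t
      have hΞtt := isTestFunctionOn_comp_sub hΞt (t • e)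
      have h := hshear (fun x => Ξ (x - t • e)) hΞtt.contDiff hΞtt.hasCompactSupport (fun z => by
        rw [fderiv_comp_sub_apply, hΞ]; exact trace_fderiv_curlPair hg.contDiff a c _)
      simpa only [fderiv_comp_sub_apply] using h
    rw [hsplit Ξ hΞt, integral_inner_comp_sub_eq_of_shear hUl hΞt e horth s, sub_self]
  -- (3) growth of `D` on balls
  set m : ℝ := 1 - 2 * ρ with hm
  have hm3 : m < 3 := by rw [hm]; linarith
  set Cp : ℝ := max C 0 with hCp
  have hCp0 : 0 ≤ Cp := le_max_right _ _
  have hgrow' : ∀ R : ℝ, 1 ≤ R → ∫⁻ z in ball (0 : EuclideanSpace ℝ (Fin 3)) R, ‖U z + κ‖ₑ ^ 2 ≤ ENNReal.ofReal (Cp * R ^ m) := by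
    intro R hR
    refine (hgrow R hR).trans (ENNReal.ofReal_le_ofReal ?_)
    exact mul_le_mul_of_nonneg_right (le_max_left _ _) (Real.rpow_nonneg (by linarith) _)
  set r₀ : ℝ := max 1 ‖s • e‖ with hr₀
  have hDgrowth : ∀ r : ℝ, r₀ < r → 0 < r →
      ∫⁻ z in ball (0 : EuclideanSpace ℝ (Fin 3)) r, ‖D z‖ₑ ^ 2 ≤ ENNReal.ofReal (4 * Cp * ((2 : ℝ) ^ m + 1) * r ^ m) := by
    intro r hr hr0
    have hr1 : 1 ≤ r := le_trans (le_max_left _ _) hr.le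
    have hrs : ‖s • e‖ ≤ r := le_trans (le_max_right _ _) hr.le
    -- pointwise: `‖D‖² ≤ 4(‖U(·+se)+κ‖² + ‖U+κ‖²)`
    have hpt : ∀ z, ‖D z‖ₑ ^ 2 ≤ 4 * (‖U (z + s • e) + κ‖ₑ ^ 2 + ‖U z + κ‖ₑ ^ 2) := by
      intro z
      have e1 : D z = (U (z + s • e) + κ) - (U z + κ) := by rw [hD]; abel
      calc ‖D z‖ₑ ^ 2 ≤ (‖U (z + s • e) + κ‖ₑ + ‖U z + κ‖ₑ) ^ 2 := by
            rw [e1]; gcongr; exact enorm_sub_le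
        _ ≤ _ := ENNReal.add_sq_le_four_mul _ _
    -- the translated ball integral
    have hUm : AEMeasurable (fun z => ‖U (z + s • e) + κ‖ₑ ^ 2) (volume.restrict (ball (0 : EuclideanSpace ℝ (Fin 3)) r)) :=
      ((hUsl.aestronglyMeasurable.add aestronglyMeasurable_const).enorm.pow_const 2).restrict
    have htrans : ∫⁻ z in ball (0 : EuclideanSpace ℝ (Fin 3)) r, ‖U (z + s • e) + κ‖ₑ ^ 2 ≤ ENNReal.ofReal (Cp * (2 * r) ^ m) := by
      rw [setLIntegral_ball_comp_add_right (fun y => ‖U y + κ‖ₑ ^ 2) (s • e) r]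
      have hsub : ball (s • e) r ⊆ ball (0 : EuclideanSpace ℝ (Fin 3)) (2 * r) := by
        intro y hy
        rw [mem_ball, dist_eq_norm] at hy
        rw [mem_ball_zero_iff]
        calc ‖y‖ ≤ ‖y - s • e‖ + ‖s • e‖ := norm_le_norm_sub_add y (s • e)
          _ < r + r := add_lt_add_of_lt_of_le hy hrs
          _ = 2 * r := by ring
      exact (lintegral_mono_set hsub).trans (hgrow' (2 * r) (by linarith))
    calc ∫⁻ z in ball (0 : EuclideanSpace ℝ (Fin 3)) r, ‖D z‖ₑ ^ 2
        ≤ ∫⁻ z in ball (0 : EuclideanSpace ℝ (Fin 3)) r, 4 * (‖U (z + s • e) + κ‖ₑ ^ 2 + ‖U z + κ‖ₑ ^ 2) :=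
          lintegral_mono fun z => hpt z
      _ = 4 * ((∫⁻ z in ball (0 : EuclideanSpace ℝ (Fin 3)) r, ‖U (z + s • e) + κ‖ₑ ^ 2) +
            ∫⁻ z in ball (0 : EuclideanSpace ℝ (Fin 3)) r, ‖U z + κ‖ₑ ^ 2) := by
          rw [lintegral_const_mul' _ _ (by norm_num), lintegral_add_left' hUm]
      _ ≤ 4 * (ENNReal.ofReal (Cp * (2 * r) ^ m) + ENNReal.ofReal (Cp * r ^ m)) :=
          mul_le_mul' le_rfl (add_le_add htrans (hgrow' r hr1))
      _ = ENNReal.ofReal (4 * Cp * ((2 : ℝ) ^ m + 1) * r ^ m) := by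
          rw [← ENNReal.ofReal_add (by positivity) (by positivity), ← ENNReal.ofReal_ofNat 4,
            ← ENNReal.ofReal_mul (by norm_num), Real.mul_rpow (by norm_num) hr0.le]
          congr 1
          ring
  -- (4) every coordinate of `D` is weakly harmonic with the same growth, hence zero
  have hcoord : ∀ i : Fin 3, (fun x => ⟪D x, EuclideanSpace.single i (1 : ℝ)⟫) =ᵐ[volume] 0 := by
    intro i
    set a : EuclideanSpace ℝ (Fin 3) := EuclideanSpace.single i (1 : ℝ) with ha
    have ha1 : ‖a‖ = 1 := by rw [ha, PiLp.norm_single, norm_one]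
    refine ae_eq_zero_of_weaklyHarmonic_of_growth (K := 4 * Cp * ((2 : ℝ) ^ m + 1)) (m := m) (r₀ := r₀) ?_ ?_ hm3 ?_
    · have e1 : (fun x => ⟪D x, a⟫) = fun x => (innerSL ℝ a) (D x) := by
        funext x; simp only [innerSL_apply_apply, real_inner_comm]
      rw [e1, ← locallyIntegrableOn_univ]
      exact (innerSL ℝ a).locallyIntegrableOn_comp (locallyIntegrableOn_univ.2 hDl)
    · intro φ hφ hφc
      have hθ : IsTestFunctionOn (⊤ : Opens (EuclideanSpace ℝ (Fin 3))) φ := ⟨hφ, hφc, by simp⟩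
      have := integral_laplacian_mul_inner_eq_zero_of_curlPair hDl hDdiv hDcurl hθ a
      rw [← this]
      exact integral_congr_ae (Eventually.of_forall fun x => by simp only [mul_comm])
    · intro r hr hr0
      refine le_trans (lintegral_mono fun x => ?_) (hDgrowth r hr hr0)
      gcongr
      rw [← ofReal_norm, ← ofReal_norm]
      exact ENNReal.ofReal_le_ofReal ((norm_inner_le_norm _ _).trans (by rw [ha1, mul_one]))
  have hall := ae_all_iff.2 hcoord
  filter_upwards [hall] with x hx
  have hDx : D x = 0 := by
    ext i
    have h1 := hx i
    simp only [Pi.zero_apply] at h1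
    rw [EuclideanSpace.inner_single_right] at h1
    simpa using h1
  have : U (x + s • e) - U x = 0 := hDx
  exact sub_eq_zero.1 this

end GalileanFrames

end Summit.NavierStokesRegularity.NavierStokesRegularity.Theorems.PowerGaugeEulerLiouville

end
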